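import Literature.NumberTheory.QuadraticForms.UnitNormIndexDefs
import Literature.NumberTheory.QuadraticForms.UnitNormIndexHerbrand
import HarnessLib

/-!
# O'Meara 65:10, arithmetic set-up: the `S`-units `𝔘` of a quadratic extension with their
# conjugation, `𝔘^σ = 𝔲`, `N 𝔘 = N_{E/F} 𝔘`, and the torsion-free part `𝔲₁` of `𝔲`

Sibling proof file of `UnitNormIndex.lean` and `UnitNormIndexHerbrand.lean` (namespace
`Literature.NumberTheory.QuadraticForms.OMeara65`); all declarations fully proved. It instantiates the
abstract Herbrand computation of `UnitNormIndexHerbrand.lean` (with the definitions of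
`UnitNormIndexDefs.lean`) in the situation of O'Meara,
*Introduction to quadratic forms*, §65B Prop. 65:10: `K` a number field, `T` a finite set of finite
places (`S = {v ∉ T}`), `E/K` a quadratic extension with non-trivial automorphism `σ`, and
`G = 𝔘 = (placesAbove K E T).unit E` the `S_E`-units of `E` (units at all places of `E` not above
`T`). Proved here:

* `ker_quotEnd_conjSUnits` — **`𝔘^σ = 𝔲`**: the `σ`-fixed `S_E`-units are the images of the
  `S`-units of `K` (Galois descent `E^σ = K` and `|r|_w = |r|_v^{e(w|v)}`);
* `map_normSUnits_subgroupOf` — **`N 𝔘 = N_{E/F} 𝔘`**: the image of `N Γ = Γ σΓ` corresponds to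
  `normSUnits K E T` (`N_{E/K} u = u σu`), so that
  `relIndex_normEnd_conjSUnits : (𝔘^σ : N 𝔘) = (𝔲 : N_{E/F} 𝔘)`;
* `powSUnits E T` (`UnitNormIndexDefs.lean`), the subgroup `𝔲₁ = 𝔲^m ≤ 𝔘^σ`: of finite
  index in `𝔘^σ` (`relIndex_powSUnits_ne_zero`), without `2`-torsion (`powSUnits_sq_eq_one`), of
  rank `rk 𝔲₁ = rk 𝔲 = rank K + |T|` (`finrank_powSUnits`, Dirichlet's `S`-unit theorem
  `Literature.NumberTheory.DiophantineGeometry.NumberField.finrank_sUnit`) — O'Meara's free part `𝔲₁` of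
  `𝔲 = 𝔲₀ × 𝔲₁` in step 2 of the proof (any torsion-free subgroup of finite index serves);
* `sq_eq_one_iff_sUnits`, `neg_one_mem_range_quotEnd` — the elements of square `1` in `𝔘` are
  `±1`, and `-1 = T(√a) ∈ T 𝔘` for `E = K(√a)` with `a` a unit off `T`.

## References

* O. T. O'Meara, *Introduction to quadratic forms*, Grundlehren 117, Springer (1963), §65A (the
  diagram `N_{E/F} 𝔘 ⊆ 𝔲`), §65B Prop. 65:10 (proof, steps 1–3), PDF pp. 179–185 of the held copy.
-/

noncomputable section

open NumberField IsDedekindDomain Module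
open scoped Valued

namespace Literature.NumberTheory.QuadraticForms.OMeara65

variable {K : Type} [Field K] [NumberField K]
variable {E : Type} [Field E] [NumberField E] [Algebra K E]

section Fixed

variable [Algebra.IsQuadraticExtension K E]

/-- **`𝔘^σ = 𝔲`** (O'Meara: "`𝔘_T` is clearly equal to `𝔲`"): the `σ`-fixed `S_E`-units of `E`, i.e.
the kernel of `T Γ = Γ/σΓ` on `𝔘`, are exactly the images of the `S`-units of `K` (an element fixed
by the non-trivial automorphism lies in `K`, and is then a unit at `v ∉ T` because it is one at a
place `w ∣ v`). [cite: Omeara1963, §65B Prop. 65:10 (proof, step 3)] -/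
theorem ker_quotEnd_conjSUnits {T : Finset (HeightOneSpectrum (𝓞 K))} {σ : E ≃ₐ[K] E} (hσ : σ ≠ 1) :
    (quotEnd (conjSUnits T σ)).ker = (sUnitsEmbedding E T).range := by
  ext u
  rw [mem_ker_quotEnd_iff, MonoidHom.mem_range]
  constructor
  · intro hu
    have hfix : σ ((u : Eˣ) : E) = (u : Eˣ) := by
      rw [← coe_conjSUnits, hu]
    obtain ⟨r, hr⟩ := QuadraticExtension.exists_algebraMap_eq_of_fixed hσ hfix
    have hr0 : r ≠ 0 := by
      rintro rfl
      rw [map_zero] at hr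
      exact (u : Eˣ).ne_zero hr.symm
    have hru : ∀ v ∉ T, v.valuation K r = 1 := fun v hv ↦ by
      have hne : (finitePlacesOver E v).ncard ≠ 0 := by
        rcases QuadraticExtension.ncard_finitePlacesOver_eq_one_or_two (K := K) (E := E) v with h | h <;>
          omega
      obtain ⟨w, hw⟩ := Set.nonempty_of_ncard_ne_zero hne
      have h1 : w.valuation E ((u : Eˣ) : E) = 1 :=
        u.2 w (by rw [mem_placesAbove_iff, mem_finitePlacesOver_iff.1 hw]; exact hv)
      rw [← hr, valuation_algebraMap_of_mem_finitePlacesOver hw, eq_comm] at h1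
      exact (pow_eq_one_iff.1 h1.symm).resolve_right (ramificationIdx'_pos_of_mem_finitePlacesOver hw).ne'
    refine ⟨⟨Units.mk0 r hr0, fun v hv ↦ by rw [Units.val_mk0]; exact hru v hv⟩, ?_⟩
    apply Subtype.ext; apply Units.ext
    rw [coe_sUnitsEmbedding]
    exact hr
  · rintro ⟨r, rfl⟩
    apply Subtype.ext; apply Units.ext
    rw [coe_conjSUnits, coe_sUnitsEmbedding, AlgEquiv.commutes]

/-- **`N 𝔘 = N_{E/F} 𝔘`**: the image of `N Γ = Γ · σΓ` on `𝔘` is the image under `𝔲 ↪ 𝔘` of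
`normSUnits K E T` (`N_{E/K} u = u · σu`, `algebraMap_algebraNorm_eq_mul_algEquiv`).
[cite: Omeara1963, §65B Prop. 65:10 (proof, step 3)] -/
theorem range_normEnd_conjSUnits {T : Finset (HeightOneSpectrum (𝓞 K))} {σ : E ≃ₐ[K] E} (hσ : σ ≠ 1) :
    (normEnd (conjSUnits T σ)).range =
      ((normSUnits K E T).subgroupOf ((↑T : Set (HeightOneSpectrum (𝓞 K))).unit K)).map
        (sUnitsEmbedding E T) := by
  ext x
  simp only [MonoidHom.mem_range, Subgroup.mem_map, Subgroup.mem_subgroupOf]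
  constructor
  · rintro ⟨u, rfl⟩
    have ht : Units.map (Algebra.norm K : E →* K) (u : Eˣ) ∈ normSUnits K E T :=
      Subgroup.mem_map_of_mem _ u.2
    refine ⟨⟨Units.map (Algebra.norm K : E →* K) (u : Eˣ), normSUnits_le_unit T ht⟩, ht, ?_⟩
    apply Subtype.ext; apply Units.ext
    rw [coe_sUnitsEmbedding]
    change algebraMap K E (Algebra.norm K ((u : Eˣ) : E)) = _
    rw [algebraMap_algebraNorm_eq_mul_algEquiv hσ]
    rfl
  · rintro ⟨r, hr, rfl⟩
    obtain ⟨u, hu, hur⟩ := mem_normSUnits_iff.1 hr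
    refine ⟨⟨u, hu⟩, ?_⟩
    apply Subtype.ext; apply Units.ext
    rw [coe_sUnitsEmbedding, ← hur, algebraMap_algebraNorm_eq_mul_algEquiv hσ]
    rfl

/-- Hence **`(𝔘^σ : N 𝔘) = (𝔲 : N_{E/F} 𝔘)`** (transport along the injection `𝔲 ↪ 𝔘`).
[cite: Omeara1963, §65B Prop. 65:10] -/
theorem relIndex_normEnd_conjSUnits {T : Finset (HeightOneSpectrum (𝓞 K))} {σ : E ≃ₐ[K] E}
    (hσ : σ ≠ 1) :
    (normEnd (conjSUnits T σ)).range.relIndex (quotEnd (conjSUnits T σ)).ker =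
      (normSUnits K E T).relIndex ((↑T : Set (HeightOneSpectrum (𝓞 K))).unit K) := by
  rw [ker_quotEnd_conjSUnits hσ, range_normEnd_conjSUnits hσ, MonoidHom.range_eq_map,
    Subgroup.relIndex_map_map_of_injective _ _ (sUnitsEmbedding_injective T),
    Subgroup.relIndex_top_right, Subgroup.relIndex]

end Fixed


/-! ### The torsion-free part `𝔲₁` -/

section PowSUnits

/-- `𝔲₁ ≤ 𝔲` (inside `𝔘`). [folklore] -/
theorem powSUnits_le_range (T : Finset (HeightOneSpectrum (𝓞 K))) :
    powSUnits E T ≤ (sUnitsEmbedding E T).range := by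
  rw [MonoidHom.range_eq_map]
  exact Subgroup.map_mono le_top

/-- The elements of `𝔲₁` are `σ`-fixed. [folklore] -/
theorem conjSUnits_eq_of_mem_powSUnits {T : Finset (HeightOneSpectrum (𝓞 K))} (σ : E ≃ₐ[K] E)
    {u : sUnitsAbove K E T} (hu : u ∈ powSUnits E T) : conjSUnits T σ u = u := by
  obtain ⟨r, rfl⟩ := powSUnits_le_range T hu
  apply Subtype.ext; apply Units.ext
  rw [coe_conjSUnits, coe_sUnitsEmbedding, AlgEquiv.commutes]

/-- The order `m` of the torsion of `𝔲` is positive. [folklore] -/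
theorem torsion_card_ne_zero (T : Finset (HeightOneSpectrum (𝓞 K))) :
    Nat.card (CommGroup.torsion ((↑T : Set (HeightOneSpectrum (𝓞 K))).unit K)) ≠ 0 :=
  Nat.card_pos.ne'

/-- `𝔲₁ = 𝔲^m` has finite index in `𝔲` (`(𝔲 : 𝔲^m) = m^{rk 𝔲} · (𝔲₀ : 𝔲₀^m)` is finite).
[cite: Omeara1963, §65B Prop. 65:10 (proof, step 2)] -/
theorem index_range_pow_ne_zero (T : Finset (HeightOneSpectrum (𝓞 K))) :
    (powMonoidHom (Nat.card (CommGroup.torsion ((↑T : Set (HeightOneSpectrum (𝓞 K))).unit K))) :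
      ((↑T : Set (HeightOneSpectrum (𝓞 K))).unit K) →* _).range.index ≠ 0 := by
  set u := ((↑T : Set (HeightOneSpectrum (𝓞 K))).unit K)
  set m := Nat.card (CommGroup.torsion u)
  have h1 : (powMonoidHom m : u →* u).range.index = (nsmulAddMonoidHom (α := Additive u) m).range.index := rfl
  rw [h1, AddSubgroup.index_range_nsmul_eq_pow_mul (torsion_card_ne_zero T)]
  haveI : Finite (AddCommGroup.torsion (Additive u)) := AddSubgroup.finite_torsion_of_moduleFinite _
  exact mul_ne_zero (pow_ne_zero _ (torsion_card_ne_zero T)) AddSubgroup.index_ne_zero_of_finite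

variable [Algebra.IsQuadraticExtension K E]

/-- `𝔲₁` has finite index in `𝔘^σ = ker T`. [cite: Omeara1963, §65B Prop. 65:10 (proof, step 2)] -/
theorem relIndex_powSUnits_ne_zero {T : Finset (HeightOneSpectrum (𝓞 K))} {σ : E ≃ₐ[K] E} (hσ : σ ≠ 1) :
    (powSUnits E T).relIndex (quotEnd (conjSUnits T σ)).ker ≠ 0 := by
  rw [ker_quotEnd_conjSUnits hσ, MonoidHom.range_eq_map, powSUnits,
    Subgroup.relIndex_map_map_of_injective _ _ (sUnitsEmbedding_injective T),
    Subgroup.relIndex_top_right]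
  exact index_range_pow_ne_zero T

omit [Algebra.IsQuadraticExtension K E] in
/-- `𝔲₁ = 𝔲^m` has no `2`-torsion (indeed no torsion): `x² = 1` forces `x = 1`. [folklore] -/
theorem powSUnits_sq_eq_one {T : Finset (HeightOneSpectrum (𝓞 K))} {x : sUnitsAbove K E T}
    (hx : x ∈ powSUnits E T) (h : x ^ 2 = 1) : x = 1 := by
  obtain ⟨_, ⟨r, rfl⟩, rfl⟩ := hx
  set m := Nat.card (CommGroup.torsion ((↑T : Set (HeightOneSpectrum (𝓞 K))).unit K)) with hm
  rw [powMonoidHom_apply, ← map_pow, ← map_one (sUnitsEmbedding E T)] at h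
  have h' : r ^ (m * 2) = 1 := by rw [pow_mul]; exact sUnitsEmbedding_injective T h
  have htor : r ∈ CommGroup.torsion ((↑T : Set (HeightOneSpectrum (𝓞 K))).unit K) := by
    rw [CommGroup.mem_torsion, isOfFinOrder_iff_pow_eq_one]
    exact ⟨m * 2, Nat.mul_pos (Nat.pos_of_ne_zero (torsion_card_ne_zero T)) two_pos, h'⟩
  have hrm : r ^ m = 1 := by
    have := pow_card_eq_one' (G := CommGroup.torsion ((↑T : Set (HeightOneSpectrum (𝓞 K))).unit K))
      (x := ⟨r, htor⟩)
    exact congrArg Subtype.val this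
  rw [powMonoidHom_apply, hrm, map_one]

omit [Algebra.IsQuadraticExtension K E] in
/-- **`rk 𝔲₁ = rk 𝔲 = rank K + |T|`** (Dirichlet's `S`-unit theorem,
`Literature.NumberTheory.DiophantineGeometry.NumberField.finrank_sUnit`; `𝔲₁ ≅ 𝔲^m` has finite index in `𝔲`).
[cite: Omeara1963, §65B Prop. 65:10 (proof, step 3: "`rank 𝔲₁ = s - 1`")] -/
theorem finrank_powSUnits (T : Finset (HeightOneSpectrum (𝓞 K))) :
    finrank ℤ (Additive (powSUnits E T)) = Units.rank K + T.card := by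
  set u := ((↑T : Set (HeightOneSpectrum (𝓞 K))).unit K)
  set R : Subgroup u := (powMonoidHom (Nat.card (CommGroup.torsion u)) : u →* u).range
  -- `𝔲₁ ≅ 𝔲^m`
  have e : R ≃* powSUnits E T := R.equivMapOfInjective _ (sUnitsEmbedding_injective T)
  rw [← (MulEquiv.toAdditive e).toIntLinearEquiv.finrank_eq,
    finrank_eq_of_index_ne_zero R (index_range_pow_ne_zero T),
    DiophantineGeometry.NumberField.finrank_sUnit, Nat.card_coe_set_eq, Set.ncard_coe_finset]

end PowSUnits


/-! ### `-1 = T(√a)` and the elements of square `1` -/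

section MinusOne

omit [NumberField K] in
/-- `-1 ≠ 1` in `𝔘` (characteristic `0`). [folklore] -/
theorem negOne_ne_one (T : Finset (HeightOneSpectrum (𝓞 K))) : negOne E T ≠ 1 := by
  intro h
  have h' := congrArg (fun z : sUnitsAbove K E T ↦ ((z : Eˣ) : E)) h
  simp only [negOne, Units.val_neg, Units.val_one, OneMemClass.coe_one] at h'
  have h2 : (2 : E) = 0 := by linear_combination -h'
  exact two_ne_zero h2

omit [NumberField K] in
/-- In `𝔘 ≤ Eˣ` the elements of square `1` are `1` and `-1`. [folklore] -/
theorem sq_eq_one_iff_sUnits {T : Finset (HeightOneSpectrum (𝓞 K))} (g : sUnitsAbove K E T) :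
    g ^ 2 = 1 ↔ g = 1 ∨ g = negOne E T := by
  have key : ((g : Eˣ) : E) ^ 2 = 1 ↔ ((g : Eˣ) : E) = 1 ∨ ((g : Eˣ) : E) = -1 := by
    rw [sq, mul_self_eq_one_iff]
  constructor
  · intro h
    have h' : ((g : Eˣ) : E) ^ 2 = 1 := by
      have := congrArg (fun z : sUnitsAbove K E T ↦ ((z : Eˣ) : E)) h
      simpa using this
    rcases key.1 h' with h1 | h1
    · left; apply Subtype.ext; apply Units.ext; simpa using h1
    · right; apply Subtype.ext; apply Units.ext; simpa [negOne] using h1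
  · rintro (rfl | rfl)
    · rw [one_pow]
    · apply Subtype.ext; apply Units.ext; simp [negOne]

/-- `√a ∈ 𝔘` when `a` is a unit off `T`: `|α|_w² = |a|_v^{e} = 1`. [folklore] -/
theorem sqrt_mem_sUnitsAbove {T : Finset (HeightOneSpectrum (𝓞 K))} {a : K} {α : E}
    (haT : ∀ v ∉ T, v.valuation K a = 1) (hα : α ^ 2 = algebraMap K E a)
    (hαK : ∀ r : K, algebraMap K E r ≠ α) :
    Units.mk0 α (QuadraticExtension.ne_zero_of_sq_eq' hα hαK) ∈ sUnitsAbove K E T := by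
  intro w hw
  rw [Units.val_mk0]
  have h := valuation_algebraMap_of_mem_finitePlacesOver (E := E) (w := w) (mem_finitePlacesOver_iff.2 rfl) a
  rw [← hα, map_pow, haT _ (by simpa [mem_placesAbove_iff] using hw), one_pow] at h
  exact (pow_eq_one_iff.1 h).resolve_right two_ne_zero

variable [Algebra.IsQuadraticExtension K E]

/-- **`-1 = T(√a) ∈ T 𝔘`** (`σ √a = -√a`). [cite: Omeara1963, §65B Prop. 65:10 (proof, step 3: "`-1 = T(√θ) ∈ T 𝔘`")] -/
theorem negOne_mem_range_quotEnd {T : Finset (HeightOneSpectrum (𝓞 K))} {σ : E ≃ₐ[K] E} (hσ : σ ≠ 1)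
    {a : K} {α : E} (haT : ∀ v ∉ T, v.valuation K a = 1) (hα : α ^ 2 = algebraMap K E a)
    (hαK : ∀ r : K, algebraMap K E r ≠ α) :
    negOne E T ∈ (quotEnd (conjSUnits T σ)).range := by
  refine ⟨⟨Units.mk0 α (QuadraticExtension.ne_zero_of_sq_eq' hα hαK), sqrt_mem_sUnitsAbove haT hα hαK⟩, ?_⟩
  apply Subtype.ext; apply Units.ext
  have hα0 := QuadraticExtension.ne_zero_of_sq_eq' hα hαK
  rw [quotEnd_apply, Subgroup.coe_div, Units.val_div_eq_div_val, coe_conjSUnits]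
  simp only [negOne, Units.val_mk0, Units.val_neg, Units.val_one]
  rw [QuadraticExtension.algEquiv_apply_eq_neg hσ hα hαK, div_neg, div_self hα0]

end MinusOne

end Literature.NumberTheory.QuadraticForms.OMeara65
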